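import Summits.ValiantsHypothesis.ValiantsHypothesis.Theorems.GeneratorObstructionsPerGenDegreeSuperQPAtomsGenerate

/-!
# Route GeneratorObstructions — K1 `PerGenDegreeSuperQP` (stmt-ValiantsHypothesis-11654),
# line `per-side-atoms`: EXTREMAL RAYS of the occurrence cone start with an atom
# (faces of `S(f)` cut out by a supporting functional; `stub_atomLate` ⇐ a long extremal ray)

Seventh support file of the line (companions `…AtomCertificates`, `…RectangularAtom`,
`…AtomsGenerate`, `…MinimalDegree`, `…RectangularRays`, `…DimensionGap`).

`…RectangularRays` proved that the occurrence monoid `S(f) = {χ : HWV_χ(ℂ[Δ_n[f]]) ≠ ⊥}` starts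
with an ATOM on each of the `m²` extremal rays `ℝ₊(1^j)^*` of the dominant CHAMBER that it meets.
Those are extremal rays of the cone `ℝ₊S(f)` only because they are extremal in the ambient
chamber. The cone `ℝ₊S(f)` — by Brion's theorem the cone over the MOMENT POLYTOPE of the
projective orbit closure — may have further extremal rays (vertices of the moment polytope that
are not chamber vertices); this happens exactly when the moment polytope is not the full simplex
slice of the chamber, i.e. when some rectangular direction `(1^j)^*` carries NO multiple in
`S(f)`. For `f = per_m` this is open in print for `m < j < m²`: the saturation of `S(per_m)`
contains every `λ` with `ℓ(λ) ≤ m` (Chow variety inside `Δ(per_m)`, the argument of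
Bürgisser–Hüttenhain–Ikenmeyer 2017 Thm. 1), and near the top vertex `𝟙/m` the cone is full
(every `λ` of the orbit monoid `S°(per_m)` has `λ + s·𝟙 ∈ S(per_m)`, BLMW 2011 §5.3, and
`S°` saturates to everything), but nothing is known in between.

This file supplies the general principle behind both cases and the resulting conditional form of
the registered stub:

1. `exists_atom_of_face_subset_ray` — **a face of `S(f)` contained in a ray starts with an
   atom.** If a property `P` of weights is FACIAL for `S(f)` (`P(χ₁+χ₂) → P χ₁ ∧ P χ₂` for
   occurring `χ₁, χ₂`), every occurring weight with `P` is a natural multiple of one weight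
   `v ≠ 0`, and some nonzero occurring weight has `P`, then the least `t₀ ≥ 1` with `t₀•v`
   occurring and `P (t₀•v)` gives an ATOM `t₀•v` of `S(f)` (no splitting into two nonzero
   occurring weights) — pure monoid combinatorics, no dominance needed.
2. `exists_atom_of_supporting_functional` — the geometric instance: an additive functional
   `φ : Weight σ →+ ℤ` with `φ ≥ 0` on `S(f)` (a SUPPORTING functional of the cone) whose face
   `S(f) ∩ ker φ` lies in a ray `ℕ•v` and is hit; then the first point of the ray is an atom.
   Every extremal ray of `ℝ₊S(f)` that meets `S(f)` is of this form (take `φ` integral, exposing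
   the ray), so: EVERY HIT EXTREMAL RAY OF THE OCCURRENCE CONE STARTS WITH AN ATOM, of degree at
   least the degree `-|v|/n` of the ray's primitive vector (`neg_size_le_neg_size_nsmul`).
3. `stub_atomLate_of_late_extremal_ray` — the registered `stub_atomLate` VERBATIM from: for
   every `c` and infinitely many `m`, the cone `ℝ₊S(per_m)` has a hit extremal ray (witnessed
   by a supporting functional `φ` and ray generator `v`) whose generator already has degree
   `-|v|/m > 2^((log₂ m + c)^c)` — "the moment polytope of `Δ(per_m)` has a vertex with a
   super-quasi-polynomial denominator". This is a mechanism for LATE atoms that none of the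
   polynomially-capped certificates of the companion files can see (full length `≤ m²`, first
   row `< 2m²`, chamber rays `j ≤ m` early); it lives precisely in the unexplored range of
   lengths `m < ℓ < m²` away from the top vertex.

Honest framing: structure lemmas and a conditional reduction; `stub_atomLate` (for `c ≥ 2`), K1
and `GenFlipThesis` remain OPEN; nothing here bears on VP versus VNP.
References: [BurgisserHuttenhainIkenmeyer2017] (arXiv:1501.05528) §1–2 (monoid of
representations, saturation, holes; Sat S(Det_n) ⊇ {ℓ ≤ n}); [BurgisserEtAl2011] §5.3 (orbit
versus orbit closure, shift by the invariant); Brion 1987 (moment polytope = normalised weight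
monoid) as background only.
-/

set_option linter.dupNamespace false

noncomputable section

namespace Summit.ValiantsHypothesis.ValiantsHypothesis.Theorems.GeneratorObstructions.PerGenDegreeSuperQP

open MvPolynomial
open Literature.NumberTheory.DiophantineGeometry Literature.Computability.AlgebraicComplexity
  Literature.Computability.Complexity

/-! ### 1. Multiples of a weight -/

section Weights

variable {σ : Type*}

/-- Entries of a natural multiple of a weight. [folklore] -/
theorem nsmul_apply_eq_mul (t : ℕ) (v : Weight σ) (i : σ) : (t • v) i = (t : ℤ) * v i := by
  simp [Pi.smul_apply]

/-- The size of a natural multiple of a weight: `|t•v| = t·|v|`. [folklore] -/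
theorem size_nsmul [Fintype σ] (t : ℕ) (v : Weight σ) : (t • v).size = (t : ℤ) * v.size := by
  unfold Weight.size
  rw [Finset.mul_sum]
  exact Finset.sum_congr rfl fun i _ => nsmul_apply_eq_mul t v i

/-- Cancellation on a ray: `t₁ • v = t₂ • v` with `v ≠ 0` forces `t₁ = t₂`. [folklore] -/
theorem nsmul_left_cancel_of_ne_zero {v : Weight σ} (hv : v ≠ 0) {t₁ t₂ : ℕ}
    (h : t₁ • v = t₂ • v) : t₁ = t₂ := by
  obtain ⟨i, hi⟩ : ∃ i, v i ≠ 0 := by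
    by_contra h'
    push Not at h'
    exact hv (funext h')
  have h' := congrFun h i
  rw [nsmul_apply_eq_mul, nsmul_apply_eq_mul] at h'
  exact_mod_cast mul_right_cancel₀ hi h'

/-- A positive multiple of a nonzero weight is nonzero. [folklore] -/
theorem nsmul_ne_zero_of_ne_zero {v : Weight σ} (hv : v ≠ 0) {t : ℕ} (ht : 0 < t) :
    t • v ≠ 0 := by
  intro h
  have := nsmul_left_cancel_of_ne_zero hv (h.trans (zero_smul ℕ v).symm)
  omega

/-- Along a ray of negative size the degree grows with the multiple: `-|v| ≤ -|t•v|` for `t ≥ 1`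
when `|v| ≤ 0`. (The first lattice point of `S(f)` on a ray has degree at least the degree of
the ray's primitive generator.) [folklore] -/
theorem neg_size_le_neg_size_nsmul [Fintype σ] {v : Weight σ} (hv : v.size ≤ 0) {t : ℕ} (ht : 0 < t) :
    -v.size ≤ -(t • v).size := by
  rw [size_nsmul]
  have : (t : ℤ) * v.size ≤ 1 * v.size :=
    Int.mul_le_mul_of_nonpos_right (by exact_mod_cast ht) hv
  linarith

end Weights

/-! ### 2. A face of the occurrence monoid contained in a ray starts with an atom -/

section Face

variable {σ : Type*} [Fintype σ] [LinearOrder σ]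

/-- **Faces in a ray start with an atom.** Let `f` be any polynomial, `n` a degree, and `P` a
property of weights that is FACIAL for the occurrence monoid of `ℂ[Δ_n[f]]`: whenever two
occurring weights have a sum satisfying `P`, both satisfy `P`. Suppose every occurring weight
with `P` is a natural multiple of a fixed weight `v ≠ 0`, and some nonzero occurring weight has
`P`. Then for the LEAST `t₀ ≥ 1` such that `t₀ • v` occurs and has `P`, the weight `t₀ • v`
is an ATOM of the occurrence monoid: a splitting `t₀•v = χ₁ + χ₂` into nonzero occurring
weights would put both `χᵢ = tᵢ•v` on the face with `1 ≤ t₁ < t₀`, against minimality.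
(Extremal-ray principle for atoms of a submonoid of a lattice.) [folklore] -/
theorem exists_atom_of_face_subset_ray (f : MvPolynomial σ ℂ) (n : ℕ) (P : Weight σ → Prop)
    (hface : ∀ χ₁ χ₂ : Weight σ, highestWeightSpace (orbitCoordRep f n) χ₁ ≠ ⊥ →
      highestWeightSpace (orbitCoordRep f n) χ₂ ≠ ⊥ → P (χ₁ + χ₂) → P χ₁ ∧ P χ₂)
    {v : Weight σ} (hv : v ≠ 0)
    (hray : ∀ χ : Weight σ, highestWeightSpace (orbitCoordRep f n) χ ≠ ⊥ → P χ → ∃ t : ℕ, χ = t • v)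
    (hhit : ∃ χ : Weight σ, highestWeightSpace (orbitCoordRep f n) χ ≠ ⊥ ∧ χ ≠ 0 ∧ P χ) :
    ∃ t₀ : ℕ, 0 < t₀ ∧ highestWeightSpace (orbitCoordRep f n) (t₀ • v) ≠ ⊥ ∧ P (t₀ • v) ∧
      (∀ t : ℕ, 0 < t → t < t₀ →
        ¬ (highestWeightSpace (orbitCoordRep f n) (t • v) ≠ ⊥ ∧ P (t • v))) ∧
      (∀ χ₁ χ₂ : Weight σ, χ₁ + χ₂ = t₀ • v → χ₁ ≠ 0 → χ₂ ≠ 0 →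
        highestWeightSpace (orbitCoordRep f n) χ₁ = ⊥ ∨
          highestWeightSpace (orbitCoordRep f n) χ₂ = ⊥) := by
  classical
  -- the face is hit at a positive multiple of `v`
  have hex : ∃ t : ℕ, 0 < t ∧ highestWeightSpace (orbitCoordRep f n) (t • v) ≠ ⊥ ∧ P (t • v) := by
    obtain ⟨χ, hocc, hne, hP⟩ := hhit
    obtain ⟨t, rfl⟩ := hray χ hocc hP
    refine ⟨t, ?_, hocc, hP⟩
    rcases Nat.eq_zero_or_pos t with h0 | h0
    · exact absurd (by rw [h0, zero_smul]) hne
    · exact h0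
  set t₀ := Nat.find hex with ht₀
  obtain ⟨ht₀pos, hocc₀, hP₀⟩ := Nat.find_spec hex
  have hmin : ∀ t : ℕ, 0 < t → t < t₀ →
      ¬ (highestWeightSpace (orbitCoordRep f n) (t • v) ≠ ⊥ ∧ P (t • v)) := by
    intro t ht hlt h
    exact Nat.find_min hex hlt ⟨ht, h.1, h.2⟩
  refine ⟨t₀, ht₀pos, hocc₀, hP₀, hmin, ?_⟩
  intro χ₁ χ₂ hsum h1 h2
  by_contra hne
  rw [not_or] at hne
  obtain ⟨hne1, hne2⟩ := hne
  obtain ⟨hP1, hP2⟩ := hface χ₁ χ₂ hne1 hne2 (by rw [hsum]; exact hP₀)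
  obtain ⟨t₁, rfl⟩ := hray χ₁ hne1 hP1
  obtain ⟨t₂, rfl⟩ := hray χ₂ hne2 hP2
  have ht₁ : 0 < t₁ := by
    rcases Nat.eq_zero_or_pos t₁ with h0 | h0
    · exact absurd (by rw [h0, zero_smul]) h1
    · exact h0
  have ht₂ : 0 < t₂ := by
    rcases Nat.eq_zero_or_pos t₂ with h0 | h0
    · exact absurd (by rw [h0, zero_smul]) h2
    · exact h0
  have hadd : t₁ + t₂ = t₀ := nsmul_left_cancel_of_ne_zero hv (by rw [add_smul]; exact hsum)
  exact hmin t₁ ht₁ (by omega) ⟨hne1, hP1⟩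

/-- **Hit extremal rays of the occurrence cone start with an atom.** Let `φ : Weight σ →+ ℤ` be
an additive functional that is nonnegative on every weight occurring in `ℂ[Δ_n[f]]` (a
SUPPORTING functional of the cone `ℝ₊S(f)`), such that the exposed face `S(f) ∩ ker φ` lies in
the ray `ℕ•v` of a weight `v ≠ 0` and contains a nonzero weight. Then the least occurring
positive multiple `t₀ • v` is an ATOM of `S(f)`. (`ker φ ∩ S(f)` is facial: `φ χ₁ + φ χ₂ = 0`
with both terms `≥ 0` forces both `= 0`.) In Brion's dictionary: every vertex of the moment
polytope of `Δ_n[f]` whose ray meets `S(f)` carries an atom at its first lattice point in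
`S(f)`. [folklore] -/
theorem exists_atom_of_supporting_functional (f : MvPolynomial σ ℂ) (n : ℕ) (φ : Weight σ →+ ℤ)
    (hsupp : ∀ χ : Weight σ, highestWeightSpace (orbitCoordRep f n) χ ≠ ⊥ → 0 ≤ φ χ)
    {v : Weight σ} (hv : v ≠ 0)
    (hray : ∀ χ : Weight σ, highestWeightSpace (orbitCoordRep f n) χ ≠ ⊥ → φ χ = 0 →
      ∃ t : ℕ, χ = t • v)
    (hhit : ∃ χ : Weight σ, highestWeightSpace (orbitCoordRep f n) χ ≠ ⊥ ∧ χ ≠ 0 ∧ φ χ = 0) :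
    ∃ t₀ : ℕ, 0 < t₀ ∧ highestWeightSpace (orbitCoordRep f n) (t₀ • v) ≠ ⊥ ∧
      (∀ t : ℕ, 0 < t → t < t₀ → highestWeightSpace (orbitCoordRep f n) (t • v) = ⊥) ∧
      (∀ χ₁ χ₂ : Weight σ, χ₁ + χ₂ = t₀ • v → χ₁ ≠ 0 → χ₂ ≠ 0 →
        highestWeightSpace (orbitCoordRep f n) χ₁ = ⊥ ∨
          highestWeightSpace (orbitCoordRep f n) χ₂ = ⊥) := by
  have hface : ∀ χ₁ χ₂ : Weight σ, highestWeightSpace (orbitCoordRep f n) χ₁ ≠ ⊥ →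
      highestWeightSpace (orbitCoordRep f n) χ₂ ≠ ⊥ → φ (χ₁ + χ₂) = 0 → φ χ₁ = 0 ∧ φ χ₂ = 0 := by
    intro χ₁ χ₂ h1 h2 h
    rw [map_add] at h
    have := hsupp χ₁ h1
    have := hsupp χ₂ h2
    constructor <;> omega
  obtain ⟨t₀, ht₀, hocc, hP, hmin, hatom⟩ :=
    exists_atom_of_face_subset_ray f n (fun χ => φ χ = 0) hface hv hray hhit
  refine ⟨t₀, ht₀, hocc, ?_, hatom⟩
  intro t ht hlt
  by_contra hne
  -- `φ (t • v) = 0` automatically: `φ v = 0` since `t₀ • v` lies on the face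
  have hφv : φ v = 0 := by
    have h := hP
    simp only [map_nsmul] at h
    rcases mul_eq_zero.mp h with h | h
    · exfalso; exact_mod_cast (ht₀.ne' (by exact_mod_cast h))
    · exact h
  exact hmin t ht hlt ⟨hne, by simp only [map_nsmul, hφv, smul_zero]⟩

end Face

/-! ### 3. The permanent: `stub_atomLate` from a long extremal ray -/

variable {m : ℕ}

/-- **Long extremal rays ⇒ late atoms.** Suppose that for every `c, m₀` some `m ≥ max(m₀,1)`
admits a supporting functional `φ` of the occurrence cone of `ℂ[Δ_m[per_m]]` (`φ ≥ 0` on all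
occurring weights) whose exposed face lies in the ray of a weight `v ≠ 0`, is hit by a nonzero
occurring weight, and whose generator is already LATE: `-|v|/m > 2^((log₂ m + c)^c)`. Then the
registered `stub_atomLate` holds verbatim: the first occurring multiple `t₀ • v`, `t₀ ≥ 1`, is
an atom (`exists_atom_of_supporting_functional`) of degree `t₀ · (-|v|/m) ≥ -|v|/m`. In words:
a vertex of the moment polytope of `Δ(per_m)` with super-quasi-polynomial denominator — or any
hit extremal ray whose first point is super-quasi-polynomially far — for infinitely many `m`.
The chamber rays `(1^j)^*` are the special case of `…RectangularRays`; the new content is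
extremal rays that are not chamber rays, which exist iff some `(1^j)^*`, necessarily with
`m < j < m²`, has no multiple in `S(per_m)` (open in print). [cite: BurgisserHuttenhainIkenmeyer2017, Thm. 1 and §2] -/
theorem stub_atomLate_of_late_extremal_ray
    (H : ∀ c m₀ : ℕ, ∃ m : ℕ, m₀ ≤ m ∧ 1 ≤ m ∧ ∃ φ : Weight (MatIdx m) →+ ℤ, ∃ v : Weight (MatIdx m),
      v ≠ 0 ∧
      (∀ χ : Weight (MatIdx m),
        highestWeightSpace (orbitCoordRep (MvPolynomial.rename toLex (perPoly (Fin m) ℂ)) m) χ ≠ ⊥ →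
          0 ≤ φ χ) ∧
      (∀ χ : Weight (MatIdx m),
        highestWeightSpace (orbitCoordRep (MvPolynomial.rename toLex (perPoly (Fin m) ℂ)) m) χ ≠ ⊥ →
          φ χ = 0 → ∃ t : ℕ, χ = t • v) ∧
      (∃ χ : Weight (MatIdx m),
        highestWeightSpace (orbitCoordRep (MvPolynomial.rename toLex (perPoly (Fin m) ℂ)) m) χ ≠ ⊥ ∧
          χ ≠ 0 ∧ φ χ = 0) ∧
      (m : ℤ) * 2 ^ ((Nat.log 2 m + c) ^ c) < -(Weight.size v)) :
    ∀ c m₀ : ℕ, ∃ m : ℕ, m₀ ≤ m ∧ 1 ≤ m ∧ ∃ χ : Weight (MatIdx m),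
      highestWeightSpace (orbitCoordRep (MvPolynomial.rename toLex (perPoly (Fin m) ℂ)) m) χ ≠ ⊥ ∧
      (∀ χ₁ χ₂ : Weight (MatIdx m), χ₁ + χ₂ = χ → χ₁ ≠ 0 → χ₂ ≠ 0 →
          highestWeightSpace (orbitCoordRep (MvPolynomial.rename toLex (perPoly (Fin m) ℂ)) m) χ₁ = ⊥ ∨
            highestWeightSpace (orbitCoordRep (MvPolynomial.rename toLex (perPoly (Fin m) ℂ)) m) χ₂ = ⊥) ∧
      (m : ℤ) * 2 ^ ((Nat.log 2 m + c) ^ c) < -(Weight.size χ) := by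
  intro c m₀
  obtain ⟨m, hm₀, hm, φ, v, hv, hsupp, hray, hhit, hlate⟩ := H c m₀
  obtain ⟨t₀, ht₀, hocc, -, hatom⟩ :=
    exists_atom_of_supporting_functional (rename toLex (perPoly (Fin m) ℂ)) m φ hsupp hv hray hhit
  refine ⟨m, hm₀, hm, t₀ • v, hocc, hatom, ?_⟩
  have hvsize : v.size ≤ 0 := by
    have : (0 : ℤ) ≤ (m : ℤ) * 2 ^ ((Nat.log 2 m + c) ^ c) := by positivity
    linarith
  exact lt_of_lt_of_le hlate (neg_size_le_neg_size_nsmul hvsize ht₀)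

end Summit.ValiantsHypothesis.ValiantsHypothesis.Theorems.GeneratorObstructions.PerGenDegreeSuperQP

end
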